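import Mathlib
import HarnessLib
import Summits.HubbardSuperconductivity.HubbardSuperconductivity.Theorems.KLProgrammeKLRegimeEngineValueClausesV17FLadder
import Summits.HubbardSuperconductivity.HubbardSuperconductivity.Theorems.KLProgrammeKLRegimeEngineV8DefsG7
import Summits.HubbardSuperconductivity.HubbardSuperconductivity.Theorems.KLProgrammeKLRegimeEngineV8DefsU6

/-!
# K3 ENGINE-FLOW child (gen 8, stmt-HubbardSuperconductivity-20437 `KLRegimeEngineV17F2`), stub (c) `stub_engine_step_values`:
# the VALUE-LANE closers BY NAME at the (R33) package `klEngGeo7` (cell gate-hubbard-kl, seat hubbard-kl-k3c2-p2 g8)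

(R33)/(R33′) (plan g17, KL STATUS l.2751/l.2782; k3c2-p1 g4's `…EngineV8DefsG7` p530135): the engine-flow render on 20437 reads the package
`klEngGeo7 := klEngGeo6.raiseE4 klE4T6`, which differs from `klEngGeo6` ONLY in `cE4` — a field no value-lane clause reads
(`pairLadderStepAtV17F2_klEngGeo7_iff`, `pairValueIncrementAtV17F_klEngGeo7_iff`, `quarticValueIncrementAtV17F_klEngGeo7_iff`,
`isoTupleL1AtV17F_klEngGeo7_iff`, `thermalBar_klEngGeo7`: all `Iff.rfl`/`rfl`).  This file re-states the stub-(c) closers of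
`…ValueClausesV17FLadder` (p528793) at the literal token `klEngGeo7`, so the registrant / the (c)-closer cite them by name:

* `klg7_package_ineq_of_isPairClassAt` — the package line `aplus·ζ(n−1) + 10·bhi ≤ ppGain n |Qm|_𝕋` HOLDS at `klEngGeo7` in the pair class;
* `klg7_band_le_thermalBar` — the thermal-band reading at `klEngGeo7` (`X ≤ C·(Klam U)²`, `C·4^T ≤ 2^80`, `nScales β ≤ n + T` ⇒ `X ≤ thermalBar klEngGeo7 …`);
* **`klvrF_pairValueIncrement_inClass_klEng7`** — in-class (E2″-F) at `klEngGeo7` from the cured (E2-F2)ₙ + (B1-F)(n−1) + two smallness lines;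
* **`klvrF_stepValues_of_reduced_klEng7`** — the four (c)-F value conjuncts at `(klEngGeo7, Q)` from the REDUCED list
  ((E2-F2)ₙ, (B1-F)(n−1), OUT-OF-CLASS (E2″-F)ₙ rows, (E5-F)ₙ, two smallness lines);
* **`klvrF_stepValues_of_reduced_klEng7_klEngU₀4`** / **`…_klEngU₀6`** — binder-keyed at `Q = klEngQ6 P R` under `0 < U ≤ klEngU₀4 P R c`, resp. the
  template's `U ≤ klEngU₀6 P R c` (`klEngU₀6_le_klEngU₀4`, `…DefsU6`); any tighter successor threshold (p1b g8's `klEngU₀7 ≤ klEngU₀6`) composes by `le_trans`;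
* **`klg7F_stepValues_of_signBlind_band`** — the whole (c)-F conclusion at `(klEngGeo7, Q)` in the thermal band from ONE sign-blind `Cp·(Klam U)²` bound.

So after the (R33) re-key the stub-(c) residue is UNCHANGED: owed = (E2-F2)ₙ (the Wick-tower composition, `pairLadderStepAtV17F2_of_wickTower_fwd`),
the OUT-OF-CLASS same-frame (E2″)ₙ rows + the frame-shift door, (E5-F)ₙ.  Bookkeeping only; every proof is the `klEngGeo6` lemma read through
the `rfl` field rows; nothing about the model is asserted; nothing asserts superconductivity.
-/

noncomputable section

namespace Summit.HubbardSuperconductivity.HubbardSuperconductivity.Theorems.KLRegimeSplit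

set_option linter.dupNamespace false -- summit = problem name (single-conjunct summit), D-0017

open Real Finset Literature.MathematicalPhysics.QuantumLattice Literature.Probability.LatticeModels
open Summit.HubbardSuperconductivity.HubbardSuperconductivity.Theorems.KLProgrammeLegKernels
open Summit.HubbardSuperconductivity.HubbardSuperconductivity.Theorems.EngineV8

section Model

variable {L M : ℕ} [NeZero L] [NeZero M] {P : SplitConsts} {Q : EngConsts} {R : RenConsts} {β U μ : ℝ} {n : ℕ}

omit [NeZero L] [NeZero M] in
/-- **The package line HOLDS at `klEngGeo7` in the pair class** (`aplus, ζ, bhi, ppGain` of `klEngGeo7` are `klEngGeo6`'s, `rfl`). -/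
theorem klg7_package_ineq_of_isPairClassAt {Qm : TorusSite 2 L} (n : ℕ) (hQm : IsPairClassAt L Qm n) :
    klEngGeo7.aplus * klEngGeo7.ζ (n - 1) + 10 * klEngGeo7.bhi ≤ klEngGeo7.ppGain n (klTorusNorm L Qm) :=
  klg6_package_ineq_of_isPairClassAt n hQm

omit [NeZero L] [NeZero M] in
/-- **Thermal-band reading at `klEngGeo7`**: `0 ≤ C`, `C·4^T ≤ 2^80`, `nScales β ≤ n + T`, `X ≤ C·(Klam U)²` ⇒ `X ≤ thermalBar klEngGeo7 P U β n`
(`thermalBar klEngGeo7 = thermalBar klEngGeo6`, `rfl`). -/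
theorem klg7_band_le_thermalBar {C X : ℝ} {T : ℕ} (hC : 0 ≤ C) (hCT : C * 4 ^ T ≤ 2 ^ 80) (hband : nScales β ≤ n + T)
    (hX : X ≤ C * (P.Klam * U) ^ 2) : X ≤ thermalBar klEngGeo7 P U β n :=
  klg6_band_le_thermalBar hC hCT hband hX

/-- **In-class (E2″-F) at the package `klEngGeo7`** (any `Q` with `Q.WF`; the two smallness lines are the registrant's U₀-door outputs). -/
theorem klvrF_pairValueIncrement_inClass_klEng7 (hP : P.WF) (hQ : Q.WF) (hn : 1 ≤ n)
    (hlad : PairLadderStepAtV17F2 L M klEngGeo7 P Q β U μ n) (harr : PairArrayAtV17F L M P Q β U μ (n - 1))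
    (hcU' : (P.C_W + klLegKappa * Q.CR * P.Klam ^ 3) * |U| ≤ 1 / 10) (hUb : |U| * klEngGeo7.bhi ≤ 1 / 8)
    {Qm : TorusSite 2 L} (hQm : IsPairClassAt L Qm n) :
    ∀ k ∈ klBall L μ 0, ∀ k' ∈ klBall L μ 0,
      ‖klPairAmplitude L M β U μ (klFlowFrameU L M β U μ n) n Qm k k' -
          klPairAmplitude L M β U μ (klFlowFrameU L M β U μ (n - 1)) (n - 1) Qm k k'‖ ≤
        gainBar klEngGeo7 P U n (klTorusNorm L Qm) (klTorusNorm L (k - k')) (klTorusNorm L (k + k' - Qm)) +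
          eremBar klEngGeo7 P Q U β L (n - 1) + thermalBar klEngGeo7 P U β n +
            legDressBarQ2 klEngGeo7 P Q U n (legSliceCountT L β μ (klFlowFrameU L M β U μ n) n ![k', Qm - k', Qm - k, k]) +
              frameShiftBar P Q U n :=
  klvrF_pairValueIncrement_inClass_klEng6 hP hQ hn hlad harr hcU' hUb hQm

/-- **The (c)-F value conjuncts from the REDUCED list at `(klEngGeo7, Q)`**: the cured ladder clause (E2-F2)ₙ, the (B1-F) envelope at `n−1`,
the OUT-OF-CLASS half of (E2″-F), (E5-F)ₙ and the two smallness lines give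
`PairLadderStepAtV17F2 ∧ PairValueIncrementAtV17F ∧ QuarticValueIncrementAtV17F ∧ IsoTupleL1AtV17F` at `(klEngGeo7, n)`. -/
theorem klvrF_stepValues_of_reduced_klEng7 (hP : P.WF) (hQ : Q.WF) (hn : 1 ≤ n)
    (hlad : PairLadderStepAtV17F2 L M klEngGeo7 P Q β U μ n) (harr : PairArrayAtV17F L M P Q β U μ (n - 1))
    (hcU' : (P.C_W + klLegKappa * Q.CR * P.Klam ^ 3) * |U| ≤ 1 / 10) (hUb : |U| * klEngGeo7.bhi ≤ 1 / 8)
    (hout : ∀ Qm : TorusSite 2 L, ¬ IsPairClassAt L Qm n → ∀ k ∈ klBall L μ 0, ∀ k' ∈ klBall L μ 0,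
      ‖klPairAmplitude L M β U μ (klFlowFrameU L M β U μ n) n Qm k k' -
          klPairAmplitude L M β U μ (klFlowFrameU L M β U μ (n - 1)) (n - 1) Qm k k'‖ ≤
        gainBar klEngGeo7 P U n (klTorusNorm L Qm) (klTorusNorm L (k - k')) (klTorusNorm L (k + k' - Qm)) +
          eremBar klEngGeo7 P Q U β L (n - 1) + thermalBar klEngGeo7 P U β n +
            legDressBarQ2 klEngGeo7 P Q U n (legSliceCountT L β μ (klFlowFrameU L M β U μ n) n ![k', Qm - k', Qm - k, k]) +
              frameShiftBar P Q U n)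
    (hE5 : IsoTupleL1AtV17F L M klEngGeo7 P β U μ n) :
    PairLadderStepAtV17F2 L M klEngGeo7 P Q β U μ n ∧ PairValueIncrementAtV17F L M klEngGeo7 P Q β U μ n ∧
      QuarticValueIncrementAtV17F L M klEngGeo7 P Q β U μ n ∧ IsoTupleL1AtV17F L M klEngGeo7 P β U μ n :=
  klvrF_stepValues_of_reduced hP hQ hn hlad harr hcU' hUb hout hE5

/-- **Binder-keyed instance at `(klEngGeo7, klEngQ6 P R)` under `0 < U ≤ klEngU₀4 P R c`** (the two smallness lines discharged:
`(klEngQ6 P R).CR = (klEngQ5 P R).CR`, `klEngGeo7.bhi = 2^24`). -/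
theorem klvrF_stepValues_of_reduced_klEng7_klEngU₀4 (hP : P.WF) (hR : R.WF) {c : ℝ} (hU : 0 < U) (hU₀ : U ≤ klEngU₀4 P R c)
    (hn : 1 ≤ n) (hlad : PairLadderStepAtV17F2 L M klEngGeo7 P (klEngQ6 P R) β U μ n)
    (harr : PairArrayAtV17F L M P (klEngQ6 P R) β U μ (n - 1))
    (hout : ∀ Qm : TorusSite 2 L, ¬ IsPairClassAt L Qm n → ∀ k ∈ klBall L μ 0, ∀ k' ∈ klBall L μ 0,
      ‖klPairAmplitude L M β U μ (klFlowFrameU L M β U μ n) n Qm k k' -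
          klPairAmplitude L M β U μ (klFlowFrameU L M β U μ (n - 1)) (n - 1) Qm k k'‖ ≤
        gainBar klEngGeo7 P U n (klTorusNorm L Qm) (klTorusNorm L (k - k')) (klTorusNorm L (k + k' - Qm)) +
          eremBar klEngGeo7 P (klEngQ6 P R) U β L (n - 1) + thermalBar klEngGeo7 P U β n +
            legDressBarQ2 klEngGeo7 P (klEngQ6 P R) U n (legSliceCountT L β μ (klFlowFrameU L M β U μ n) n ![k', Qm - k', Qm - k, k]) +
              frameShiftBar P (klEngQ6 P R) U n)
    (hE5 : IsoTupleL1AtV17F L M klEngGeo7 P β U μ n) :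
    PairLadderStepAtV17F2 L M klEngGeo7 P (klEngQ6 P R) β U μ n ∧ PairValueIncrementAtV17F L M klEngGeo7 P (klEngQ6 P R) β U μ n ∧
      QuarticValueIncrementAtV17F L M klEngGeo7 P (klEngQ6 P R) β U μ n ∧ IsoTupleL1AtV17F L M klEngGeo7 P β U μ n :=
  klvrF_stepValues_of_reduced_klEngU₀4 hP hR hU hU₀ hn hlad harr hout hE5

/-- **The same under the template's binder `U ≤ klEngU₀6 P R c`** (`klEngU₀6 ≤ klEngU₀4`, `…DefsU6`); a successor threshold
`klEngU₀7 ≤ klEngU₀6` (p1b g8's (E3-THR) door) composes by one more `le_trans`. -/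
theorem klvrF_stepValues_of_reduced_klEng7_klEngU₀6 (hP : P.WF) (hR : R.WF) {c : ℝ} (hU : 0 < U) (hU₀ : U ≤ klEngU₀6 P R c)
    (hn : 1 ≤ n) (hlad : PairLadderStepAtV17F2 L M klEngGeo7 P (klEngQ6 P R) β U μ n)
    (harr : PairArrayAtV17F L M P (klEngQ6 P R) β U μ (n - 1))
    (hout : ∀ Qm : TorusSite 2 L, ¬ IsPairClassAt L Qm n → ∀ k ∈ klBall L μ 0, ∀ k' ∈ klBall L μ 0,
      ‖klPairAmplitude L M β U μ (klFlowFrameU L M β U μ n) n Qm k k' -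
          klPairAmplitude L M β U μ (klFlowFrameU L M β U μ (n - 1)) (n - 1) Qm k k'‖ ≤
        gainBar klEngGeo7 P U n (klTorusNorm L Qm) (klTorusNorm L (k - k')) (klTorusNorm L (k + k' - Qm)) +
          eremBar klEngGeo7 P (klEngQ6 P R) U β L (n - 1) + thermalBar klEngGeo7 P U β n +
            legDressBarQ2 klEngGeo7 P (klEngQ6 P R) U n (legSliceCountT L β μ (klFlowFrameU L M β U μ n) n ![k', Qm - k', Qm - k, k]) +
              frameShiftBar P (klEngQ6 P R) U n)
    (hE5 : IsoTupleL1AtV17F L M klEngGeo7 P β U μ n) :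
    PairLadderStepAtV17F2 L M klEngGeo7 P (klEngQ6 P R) β U μ n ∧ PairValueIncrementAtV17F L M klEngGeo7 P (klEngQ6 P R) β U μ n ∧
      QuarticValueIncrementAtV17F L M klEngGeo7 P (klEngQ6 P R) β U μ n ∧ IsoTupleL1AtV17F L M klEngGeo7 P β U μ n :=
  klvrF_stepValues_of_reduced_klEng7_klEngU₀4 hP hR hU (hU₀.trans (klEngU₀6_le_klEngU₀4 P R c)) hn hlad harr hout hE5

/-- **The whole (c)-F conclusion in the thermal band at `(klEngGeo7, Q)` from ONE sign-blind bound**: `1 ≤ n`, `nScales β ≤ n + T`,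
`‖𝒞_n[K_n] − 𝒞_{n−1}[K_{n−1}]‖ ≤ Cp·(Klam U)²` on the bare ball for every `Qm`, `Cp·4^T ≤ 2^80`, and (E5-F)ₙ by name. -/
theorem klg7F_stepValues_of_signBlind_band {T : ℕ} {Cp : ℝ} (hP : P.WF) (hQ : Q.WF) (hn : 1 ≤ n) (hband : nScales β ≤ n + T)
    (hCp : 0 ≤ Cp) (hCpT : Cp * 4 ^ T ≤ 2 ^ 80)
    (hpair : ∀ Qm : TorusSite 2 L, ∀ k ∈ klBall L μ 0, ∀ k' ∈ klBall L μ 0,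
      ‖klPairAmplitude L M β U μ (klFlowFrameU L M β U μ n) n Qm k k' -
          klPairAmplitude L M β U μ (klFlowFrameU L M β U μ (n - 1)) (n - 1) Qm k k'‖ ≤ Cp * (P.Klam * U) ^ 2)
    (hE5 : IsoTupleL1AtV17F L M klEngGeo7 P β U μ n) :
    PairLadderStepAtV17F2 L M klEngGeo7 P Q β U μ n ∧ PairValueIncrementAtV17F L M klEngGeo7 P Q β U μ n ∧
      QuarticValueIncrementAtV17F L M klEngGeo7 P Q β U μ n ∧ IsoTupleL1AtV17F L M klEngGeo7 P β U μ n :=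
  klg6F_stepValues_of_signBlind_band (Q := Q) hP hQ hn hband hCp hCpT hpair hE5

end Model

end Summit.HubbardSuperconductivity.HubbardSuperconductivity.Theorems.KLRegimeSplit

end
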